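import Summits.ResolutionOfSingularities.ResolutionOfSingularities.Theorems.FrobeniusClosingSteerNestedCohenFrames
import Summits.ResolutionOfSingularities.ResolutionOfSingularities.Theorems.FrobeniusClosingSteerCoeffFieldSeparableStep
import HarnessLib

/-!
# Crux `Steer` (stmt-ResolutionOfSingularities-16345), chain W4.1, K3ᴳ / ℓ-COMPARISON plan B STEP 1 (completed level): NESTED COHEN FRAMES along a
# residually SEPARABLE local homomorphism of complete regular local rings sending an r.s.o.p. to an r.s.o.p.

OURS (campaign `res-hironaka`, rung L ★L-G4, slot W4.1; seat res-L0-w41-stub-2 g6; `K3G/JacobianLengthEtale-PLAN.md` §v1.1 STEP 1). Theses-free,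
definition-free. The separable sibling of `NestedFrames.exists_nested_frames_of_section` (p556826): the rationality step `exists_section_of_rational` is replaced by
res-D-lib-1's K-GG2 (a) `TwoBasis.exists_coeffField_comp_eq` (coefficient fields nest along a residually separable local map into a complete ring), the exponent
matrix is the identity (an UNRAMIFIED enlargement maps a regular system of parameters to one), and the coefficient map `ρ = κ(ψ)` is the residue field map (no
longer an isomorphism). With `JacobianLength.length_quotient_span_derivation_le_of_frames` (p568046) this is the frame square the ℓ-comparison consumes, stated
for the COMPLETED rings (the K3ᴳ producer supplies `ψ := ` the completed étale-local enlargement and its residual separability). [cite: Matsumura1987, Thm. 28.3] [folklore]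

* `NestedFrames.exists_nested_frame_of_separable`.
-/

noncomputable section

set_option linter.dupNamespace false

open IsLocalRing MvPowerSeries
open Literature.AlgebraicGeometry.Resolution
open Summit.ResolutionOfSingularities.ResolutionOfSingularities.Theorems.SwitchingDichotomy

namespace Summit.ResolutionOfSingularities.ResolutionOfSingularities.Theorems.SwitchingDichotomy.NestedFrames

/-- **Nested Cohen frames along a residually separable local map of complete regular local rings** (`ψ xᵢ = yᵢ` on regular systems of parameters): given a
coefficient field `σ_A` of `A` and a frame of `A` adapted to `(σ_A, x)`, there are a NESTED coefficient field `σ_B` of `B` (`σ_B ∘ κ(ψ) = ψ ∘ σ_A`) and a frame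
of `B` adapted to `(σ_B, y)` in which `ψ` reads as the change of coefficients `map κ(ψ)`. [cite: Matsumura1987, Thm. 28.3, Thm. 29.7] [folklore] -/
theorem exists_nested_frame_of_separable {A B : Type} [CommRing A] [CommRing B] [IsRegularLocalRing A] [IsRegularLocalRing B]
    [IsAdicComplete (maximalIdeal B) B] (ψ : A →+* B) [IsLocalHom ψ]
    {n : ℕ} (hnB : (maximalIdeal B).spanFinrank = n)
    (x : Fin n → A) (hx : Ideal.span (Set.range x) = maximalIdeal A) (y : Fin n → B) (hy : Ideal.span (Set.range y) = maximalIdeal B)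
    (hrel : ∀ i, ψ (x i) = y i)
    (σA : ResidueField A →+* A) (hσA : ∀ c, residue A (σA c) = c)
    (frameA : A ≃+* MvPowerSeries (Fin n) (ResidueField A)) (hfAx : ∀ i, frameA (x i) = X i) (hfAσ : ∀ c, frameA (σA c) = C c)
    (hsep : @Algebra.IsSeparable (ResidueField A) (ResidueField B) _ _ (ResidueField.map ψ).toAlgebra) :
    ∃ (frameB : B ≃+* MvPowerSeries (Fin n) (ResidueField B)) (σB : ResidueField B →+* B),
      (∀ c, residue B (σB c) = c) ∧ (∀ i, frameB (y i) = X i) ∧ (∀ c, frameB (σB c) = C c) ∧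
      (∀ b, constantCoeff (frameB b) = residue B b) ∧
      ∀ a, frameB (ψ a) = MvPowerSeries.map (ResidueField.map ψ) (frameA a) := by
  classical
  -- the nested coefficient field of `B` (K-GG2 (a))
  have hσA' : (residue A).comp σA = RingHom.id _ := RingHom.ext hσA
  obtain ⟨σB, hσB', hnest⟩ := TwoBasis.exists_coeffField_comp_eq ψ σA hσA' hsep
  have hσB : ∀ c, residue B (σB c) = c := fun c => RingHom.congr_fun hσB' c
  -- the frame of `B`
  obtain ⟨frameB, hfBy, hfBσ, hfBres⟩ := exists_frame_of_section σB hσB hnB y hy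
  refine ⟨frameB, σB, hσB, hfBy, hfBσ, hfBres, ?_⟩
  -- agreement on `σ_A` and on `x`
  have hagree := ringHom_eq_of_agree σA hσA x hx (frameB.toRingHom.comp ψ)
    ((MvPowerSeries.map (ResidueField.map ψ)).comp frameA.toRingHom)
    (fun c => by
      simp only [RingHom.comp_apply, RingEquiv.toRingHom_eq_coe, RingHom.coe_coe]
      rw [show ψ (σA c) = σB (ResidueField.map ψ c) from (RingHom.congr_fun hnest c).symm, hfBσ, hfAσ, map_C])
    (fun i => by
      simp only [RingHom.comp_apply, RingEquiv.toRingHom_eq_coe, RingHom.coe_coe]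
      rw [hrel, hfBy, hfAx, map_X])
    (fun i => by
      simp only [RingHom.comp_apply, RingEquiv.toRingHom_eq_coe, RingHom.coe_coe]
      rw [hrel, hfBy, constantCoeff_X])
  intro a
  have := congrArg (fun f => f a) hagree
  simpa only [RingHom.comp_apply, RingEquiv.toRingHom_eq_coe, RingHom.coe_coe] using this

end Summit.ResolutionOfSingularities.ResolutionOfSingularities.Theorems.SwitchingDichotomy.NestedFrames

end
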